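import Literature.MathematicalPhysics.QuantumFieldTheory.Balaban1983to89.B1Eq335FluctuationMeasure
import Literature.MathematicalPhysics.QuantumFieldTheory.Balaban1983to89.B1RG242Torus

/-!
# `Balaban1983to89.B1Eq333FluctuationTorus` — [Balaban1982Higgs1] p. 617 (3.33)/(3.35), (2.19)/(2.40): the iterated
renormalization transformation = nested Gaussian fluctuation integrals (`B1Eq333FluctuationIntegrals.rtIter_eq`)
FOR BAŁABAN'S CONCRETE OPERATORS ON THE TORI (U = 1) — the tower `B1RG242Torus.tower P a m²` (Q_j = L^{−jd}Σ_{B^j(y)},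
Q = L^{−d}Σ_{B(y)}, their (1.5)-adjoints, H = −Δ^ε + m², a_j = `B1.aSeq a L j`, weights ε^d, (L^jε)^d) — with NO
hypothesis left except `0 < a`, `0 ≤ m²`

HONEST FRAMING (cell `lit-balaban`, verbatim): statement-level skeleton of published theorems with citation tags;
proofs where landed; nothing here is a claim about the Yang–Mills mass gap.

CITATION HEADER.  T. Bałaban, *(Higgs)₂,₃ quantum fields in a finite volume. I. A lower bound*, Commun. Math.
Phys. **85** (1982) 603–626, doi:10.1007/bf01403506 [Balaban1982Higgs1] (cell paper B1; PDF held
`paper:balaban1982-cmp85-higgs23-i`, journal page = PDF page + 602; pp. 609–612, 617–618 READ AS IMAGES on the ×2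
renders `run/shared/lean/pub/pub-balaban/b2b-balaban-ref1/pages/1982-cmp85-higgs23-I/…-p007…p016-x2.png`).  Unit
`lit-balaban-p14` (Phase-2 proof seat p14, gen 6; companion of `B1Eq333FluctuationIntegrals`/`B1Eq335FluctuationMeasure`,
same seat), HOME
`run/shared/lean/pub/lit-balaban/`; SKELETON rows **B1.Eq3.33** (p. 617 sentence, MODEL INSTANCE), **B1.Eq2.17**
((2.18)/(2.19) iterated, MODEL INSTANCE), **B1.Eq2.39** ((2.40)).

WHAT IS PRINTED (verbatim).  p. 608 [PDF 6]: *"Let us define a renormalization transformation T_{a,L} in the space of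
densities … by the formula (2.6) with N = d and external field A = 0"*; p. 610 [PDF 8]: *"From (2.16) we have
Z^ε_k(Ω,A)exp(−½⟨ψ,Δ^{(k),L^kε}(Ω,A)ψ⟩) = T^ε_{a_k,L^k,A}[Ω,exp(−½⟨φ,(−Δ^{ε,N}_{A,Ω}+m²)φ⟩)]. (2.19)"*; p. 612 [PDF 10]:
*"Z^ε_k(Ω,A) = Z^{(k−1),L^{k−1}ε}(Ω,A)·…·Z^{(1),Lε}(Ω,A)Z^{(0),ε}(Ω,A), (2.40)"*; p. 617 [PDF 15]: *"after k successive
renormalization transformations together with the corresponding translations, the field A with which we have started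
in the first step is represented as A = A′^{(0),ε} + A′^{(1),ε} + … + A′^{(k−1),ε} + A^{(k),ε}, (3.33) … The fields A′_j
defining the components of (3.33) are independent Gaussian random variables with the covariances C^{(j),L^jε}."*

WHAT THIS MODULE PROVES (theorems only; 0 `sorry`, axioms standard).  The Euclidean hypotheses of
`B1Eq333FluctuationIntegrals.rtIter_eq` HOLD for the concrete tower: the weights `B1RG242Torus.weight` (= s^d·1) give
symmetric scalar products (`weight_comm`), −Δ^s + m² = m²·1 + Σ_μ∂ᵀ_μ∂_μ is a symmetric matrix (`hOp_transpose`,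
`dotProduct_hOp_comm`, `form_H_comm`); `B1RG242Torus.consistent`/`scalarProducts` (r-cell `pub-balaban`, kernel-checked)
supply `Tower.Consistent` and the adjointness of Q*_j, Q*.  Hence, for `0 < a`, `0 ≤ m²`, every kernel-constant
sequence `c`, every `F`, `n`, `B`:
* `rtIter_eq_torus` — **(3.33)/(3.35) for Bałaban's operators**: the (n+1)-fold transformation of `e^{−½⟨A,(−Δ^ε+m²)A⟩}F(A)`
  on T_ε equals `(∏c_j)·e^{−½⟨B,Δ^{(n+1)}B⟩}·∫dA′_n e^{−½⟨A′_n,(C^{(n)})⁻¹A′_n⟩}⋯∫dA′₀ e^{−½⟨A′₀,(C^{(0)})⁻¹A′₀⟩}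
  F(A′₀ + Σ_{j=1}^{n}a_j(L^jε)⁻²G^ε_jQ*_jA′_j + a_{n+1}(L^{n+1}ε)⁻²G^ε_{n+1}Q*_{n+1}B)`;
* `rtIter_one_torus` — **(2.19) with the chain (2.16) and the product (2.40)** for Bałaban's operators:
  `T^{L^nε}_{a,L}⋯T^ε_{a,L}[e^{−½⟨φ,(−Δ^ε+m²)φ⟩}](ψ) = Z_{n+1}·e^{−½⟨ψ,Δ^{(n+1)}ψ⟩}`,
  `Z_{n+1} = (∏c_j)·∫dA′₀e^{−½⟨A′₀,(C^{(0)})⁻¹A′₀⟩}·∏_{j=1}^{n}∫dA′_je^{−½⟨A′_j,(C^{(j)})⁻¹A′_j⟩}`.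
* `law_isProbabilityMeasure_torus`, `law₀_isProbabilityMeasure_torus`, `rtIter_eq_mean_torus` — via the companion
  `B1Eq335FluctuationMeasure`: the laws `dμ_j = gaussProb (W_j(C^{(j)})⁻¹)` of the A′_j ARE probability measures for the
  concrete operators (positive definiteness of `(C^{(j),L^jε})⁻¹`, `(C^{(0),ε})⁻¹` on the torus, PROVED), and the p. 617
  sentence in probabilistic form — iterated expectation over independent centred Gaussian A′_j — holds unconditionally.
Scope as in `B1RG242Torus`: U = 1 (the vector field's own transformation, p. 608), the whole torus (no Ω), the
completion convention of `Setup` above the coarsest level; nothing quantitative.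
-/

namespace Literature.MathematicalPhysics.QuantumFieldTheory.Balaban1983to89.B1Eq333FluctuationTorus

open MeasureTheory Matrix B1RG242 B1RG242Torus B1Eq333FluctuationIntegrals B1Eq335FluctuationMeasure

noncomputable section

variable (P : Params)

/-! ## 1. The symmetric structure of the concrete scalar products and of −Δ^ε + m² -/

/-- The (1.5) scalar product `⟨u,v⟩ = s^d Σ u·v` is symmetric. [cite: Balaban1982Higgs1, (1.5) p.604] -/
theorem weight_comm {i : ℕ} (s : ℝ) (u v : Site P i → ℝ) :
    u ⬝ᵥ (weight P i s *ᵥ v) = v ⬝ᵥ (weight P i s *ᵥ u) := by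
  rw [dotProduct_weight_mulVec, dotProduct_weight_mulVec, dotProduct_comm]

/-- −Δ^s + m² = m²·1 + Σ_μ ∂ᵀ_μ∂_μ is a symmetric matrix (*"−Δ^ε = ∂^{ε*}∂^ε"*, p. 605).
[cite: Balaban1982Higgs1, (1.11) p.605] -/
theorem hOp_transpose {i : ℕ} (s msq : ℝ) : (hOp P i s msq)ᵀ = hOp P i s msq := by
  simp only [hOp, Matrix.transpose_add, Matrix.transpose_smul, Matrix.transpose_one, Matrix.transpose_sum,
    Matrix.transpose_mul, Matrix.transpose_transpose]

/-- `⟨f,(−Δ^s + m²)g⟩ = ⟨g,(−Δ^s + m²)f⟩` (plain sums). [cite: Balaban1982Higgs1, (1.11) p.605] -/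
theorem dotProduct_hOp_comm {i : ℕ} (s msq : ℝ) (f g : Site P i → ℝ) :
    f ⬝ᵥ (hOp P i s msq *ᵥ g) = g ⬝ᵥ (hOp P i s msq *ᵥ f) := by
  rw [Matrix.dotProduct_mulVec, ← Matrix.mulVec_transpose, hOp_transpose, dotProduct_comm]

/-- H = −Δ^ε + m² of the tower is symmetric for the (1.5) scalar product on T_ε. [cite: Balaban1982Higgs1, (1.11) p.605] -/
theorem form_H_comm (a msq : ℝ) (φ ψ : Site P 0 → ℝ) :
    φ ⬝ᵥ (WE P *ᵥ ((tower P a msq).H *ᵥ ψ)) = ψ ⬝ᵥ (WE P *ᵥ ((tower P a msq).H *ᵥ φ)) := by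
  show φ ⬝ᵥ (weight P 0 P.eps *ᵥ (hOp P 0 P.eps msq *ᵥ ψ)) = ψ ⬝ᵥ (weight P 0 P.eps *ᵥ (hOp P 0 P.eps msq *ᵥ φ))
  rw [dotProduct_weight_mulVec, dotProduct_weight_mulVec, dotProduct_hOp_comm]

/-- The (1.5) scalar product on T_ε is symmetric. [cite: Balaban1982Higgs1, (1.5) p.604] -/
theorem WE_comm (u v : Site P 0 → ℝ) : u ⬝ᵥ (WE P *ᵥ v) = v ⬝ᵥ (WE P *ᵥ u) := weight_comm P _ u v

/-- The (1.5) scalar product on T^{(j)} is symmetric. [cite: Balaban1982Higgs1, (1.5) p.604] -/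
theorem W_comm (j : ℕ) (u v : Site P j → ℝ) : u ⬝ᵥ (W P j *ᵥ v) = v ⬝ᵥ (W P j *ᵥ u) := weight_comm P _ u v

/-- The (1.5) scalar product on T_ε is positive definite (ε > 0). [cite: Balaban1982Higgs1, (1.5) p.604] -/
theorem WE_pos (u : Site P 0 → ℝ) (hu : u ≠ 0) : 0 < u ⬝ᵥ (WE P *ᵥ u) := weight_posDef P.eps_pos u hu

/-! ## 2. The model instances -/

/-- **(3.33)/(3.35) for Bałaban's concrete tower on the tori**, unconditionally in `0 < a`, `0 ≤ m²`: the (n+1)-fold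
renormalization transformation (chain (2.16), U = 1) of `e^{−½⟨A,(−Δ^ε+m²)A⟩}F(A)` with the translations (3.10)/(3.41)
is `(∏c_j)·e^{−½⟨B,Δ^{(n+1)}B⟩_{n+1}}` times the nested Gaussian fluctuation integral of (3.35) of `F` at the decomposition
(3.33). [cite: Balaban1982Higgs1, (3.33) p.617] -/
theorem rtIter_eq_torus {a msq : ℝ} (ha : 0 < a) (hm : 0 ≤ msq) (c : ℕ → ℝ) (F : (Site P 0 → ℝ) → ℝ) (n : ℕ)
    (B : Site P (n + 1) → ℝ) :
    rtIter (tower P a msq) (WE P) (W P) c F n B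
      = (∏ j ∈ Finset.range (n + 1), c j)
        * (Real.exp (-(1 / 2 * (B ⬝ᵥ (W P (n + 1) *ᵥ (((tower P a msq).step (n + 1)).Δk *ᵥ B)))))
          * fluctInt (tower P a msq) (W P) (fun v => ∫ A' : Site P 0 → ℝ, flW₀ (tower P a msq) (WE P) A' * F (A' + v))
              n (bg (tower P a msq) (n + 1) B)) :=
  rtIter_eq c (consistent P ha hm) (scalarProducts P ha hm) (WE_comm P) (fun j _ => W_comm P j) (form_H_comm P a msq)
    F n B

/-- **(2.19) along the chain (2.16) with the product (2.40), for Bałaban's concrete tower**: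
`T^{L^nε}_{a,L}⋯T^ε_{a,L}[e^{−½⟨φ,(−Δ^ε+m²)φ⟩}](ψ) = Z_{n+1}·e^{−½⟨ψ,Δ^{(n+1)}ψ⟩_{n+1}}`, `Z_{n+1} = (∏c_j)·∫dA′₀
e^{−½⟨A′₀,(C^{(0)})⁻¹A′₀⟩}·∏_{j=1}^{n}∫dA′_je^{−½⟨A′_j,(C^{(j)})⁻¹A′_j⟩}` (each level its own factor: (2.40)); `0 < a`, `0 ≤ m²`.
[cite: Balaban1982Higgs1, (2.19) p.610, (2.40) p.612] -/
theorem rtIter_one_torus {a msq : ℝ} (ha : 0 < a) (hm : 0 ≤ msq) (c : ℕ → ℝ) (n : ℕ) (B : Site P (n + 1) → ℝ) :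
    rtIter (tower P a msq) (WE P) (W P) c (fun _ => 1) n B
      = ((∏ j ∈ Finset.range (n + 1), c j) * ((∫ A' : Site P 0 → ℝ, flW₀ (tower P a msq) (WE P) A')
          * ∏ j ∈ Finset.Icc 1 n, ∫ A' : Site P j → ℝ, flW (tower P a msq) (W P) j A'))
        * Real.exp (-(1 / 2 * (B ⬝ᵥ (W P (n + 1) *ᵥ (((tower P a msq).step (n + 1)).Δk *ᵥ B))))) :=
  rtIter_one c (consistent P ha hm) (scalarProducts P ha hm) (WE_comm P) (fun j _ => W_comm P j) (form_H_comm P a msq)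
    n B

/-! ## 3. The fluctuation laws of the concrete tower are probability measures; the normalised identity -/

/-- For Bałaban's concrete tower the law `dμ_j = gaussProb (W_j(C^{(j),L^jε})⁻¹)` of A′_j (j ≥ 1) IS a probability
measure with positive Gaussian mass — `(C^{(j),L^jε})⁻¹` positive definite on the torus, `0 < a`, `0 ≤ m²`, no other
hypothesis (`B1Eq335FluctuationMeasure.law_isProbabilityMeasure`; `cinvW` = `W_j·(C^{(j)})⁻¹`, the matrix of the law for
the plain dot product). [cite: Balaban1982Higgs1, (3.33) p.617] -/
theorem law_isProbabilityMeasure_torus {a msq : ℝ} (ha : 0 < a) (hm : 0 ≤ msq) (j : ℕ) (hj : 1 ≤ j) :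
    IsProbabilityMeasure (B2Eq228Conditioning.gaussProb (cinvW (tower P a msq) (W P) j))
      ∧ 0 < B13GaugeDevices.gaussNorm (cinvW (tower P a msq) (W P) j) :=
  law_isProbabilityMeasure (consistent P ha hm) (scalarProducts P ha hm) (WE_comm P) (fun j _ => W_comm P j)
    (form_H_comm P a msq) j hj

/-- The level-0 law `dμ₀ = gaussProb (W_E(C^{(0),ε})⁻¹)`, `C^{(0),ε} = G^ε_1`, is a probability measure with positive mass
for the concrete tower (`ginvW` = `W_E·(C^{(0),ε})⁻¹`, `(C^{(0),ε})⁻¹ = a(Lε)⁻²Q*₁Q₁ + (−Δ^ε + m²)` with a₁ = a,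
`B1RG242Torus.G_one`). [cite: Balaban1982Higgs1, (3.33) p.617] -/
theorem law₀_isProbabilityMeasure_torus {a msq : ℝ} (ha : 0 < a) (hm : 0 ≤ msq) :
    IsProbabilityMeasure (B2Eq228Conditioning.gaussProb (ginvW (tower P a msq) (WE P)))
      ∧ 0 < B13GaugeDevices.gaussNorm (ginvW (tower P a msq) (WE P)) :=
  law₀_isProbabilityMeasure (consistent P ha hm) (scalarProducts P ha hm 1 le_rfl) (WE_pos P) (W_comm P 1)
    (form_H_comm P a msq)

/-- **The p. 617 sentence in probabilistic form for Bałaban's concrete tower, unconditionally in `0 < a`, `0 ≤ m²`**: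
after n + 1 steps the density at `B` is `(∏c_j)·e^{−½⟨B,Δ^{(n+1)}B⟩}·Z₀·(∏_{j=1}^{n}Z_j)·∫dμ_n(A′_n)⋯∫dμ_1(A′_1)∫dμ₀(A′₀)
F(A′₀ + Σ_{j=1}^{n}a_j(L^jε)⁻²G^ε_jQ*_jA′_j + a_{n+1}(L^{n+1}ε)⁻²G^ε_{n+1}Q*_{n+1}B)` with every `dμ_j` a centred Gaussian
PROBABILITY measure (covariance C^{(j),L^jε} for the (1.5) product) and all masses `Z_j > 0`.
[cite: Balaban1982Higgs1, (3.33) p.617] -/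
theorem rtIter_eq_mean_torus {a msq : ℝ} (ha : 0 < a) (hm : 0 ≤ msq) (c : ℕ → ℝ) (F : (Site P 0 → ℝ) → ℝ) (n : ℕ)
    (B : Site P (n + 1) → ℝ) :
    rtIter (tower P a msq) (WE P) (W P) c F n B
      = (∏ j ∈ Finset.range (n + 1), c j)
        * (Real.exp (-(1 / 2 * (B ⬝ᵥ (W P (n + 1) *ᵥ (((tower P a msq).step (n + 1)).Δk *ᵥ B)))))
          * ((B13GaugeDevices.gaussNorm (ginvW (tower P a msq) (WE P))
              * ∏ j ∈ Finset.Icc 1 n, B13GaugeDevices.gaussNorm (cinvW (tower P a msq) (W P) j))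
            * fluctMean (tower P a msq) (W P) (fun v => ∫ A' : Site P 0 → ℝ, F (A' + v)
                ∂(B2Eq228Conditioning.gaussProb (ginvW (tower P a msq) (WE P))))
                n (bg (tower P a msq) (n + 1) B))) :=
  rtIter_eq_mean' c (consistent P ha hm) (scalarProducts P ha hm) (WE_pos P) (WE_comm P) (fun j _ => W_comm P j)
    (form_H_comm P a msq) F n B

end

end Literature.MathematicalPhysics.QuantumFieldTheory.Balaban1983to89.B1Eq333FluctuationTorus
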